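import Literature.Analysis.PDE.EvansKrylovOscillationStep
import HarnessLib

/-!
# The Evans–Krylov oscillation decay (Gilbarg–Trudinger §17.4, (17.49)–(17.51))

The measure-theoretic heart of the interior `C^{2,α}` estimate for concave fully nonlinear
equations (GT Theorem 17.14): for finitely many `C²` functions `h_k` (the pure second
derivatives `D_{γ_kγ_k}u` in the Motzkin–Wasow directions, normalized to take values in `[0,1]`
on `B̄_R(y₀)`) such that `w_k = h_k + ε Σ_l h_l²` are supersolutions `a : D²w_k ≥ -f₀` and which
are coupled by `Σ_k β_k(y)(h_k(y) - h_k(x)) ≤ D₁R` with `λ* ≤ β_k ≤ Λ*`, the oscillation sum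
`ω(r) = Σ_k osc_{B_r(y₀)} h_k` (`oscSum`) decays:

`ω(αR) ≤ δ ω(R) + C (ε ω(R) + D₁ R + f₀ R²)` (`oscillation_decay`),

with `δ ∈ (0,1)` and `C` depending only on `n`, `λ, Λ, λ*, Λ*` and the number of functions.

Design: we use the tree's small-ball weak Harnack inequality `KrylovSafonov.weakHarnack`
(average and infimum over the same ball `B_{αR}(y₀)`, `α = alphaWH ι = 1/(4√n)`), so GT's ratio
`1/2` (balls `B_R ⊆ B_{2R}`) is replaced by `α`; and we work with `p`-th powers
(`0 < p = pWH ≤ 1`, `pWH_le_one`) and the power-mean inequalities of `EvansKrylovPowerMean`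
instead of the quasi-norms `Φ_p`. GT's argument (p. 479–480): the weak Harnack inequality for
`W_k - w_k` gives (17.49) for each `k` (`setLIntegral_rpow_sup_sub_le`); the coupling bounds
`h_l - inf h_l` pointwise by `D₁R + Λ* Σ_{k≠l}(M_k - h_k)` ((17.50)–(17.51),
`osc_add_two_mul_le_pointwise`); adding, the left side `osc h_l + 2N` is constant on `B_{αR}`,
and integrating, dividing by `|B_{αR}| = αⁿRⁿ|B₁|` and taking `p`-th roots
(`oscillation_decay_algebra`) yields the decay. The level `N = f₀R²/λ + εω(R) > 0` is used when
`ω(R) > 0`; the case `ω(R) = 0` is trivial. Everything here is proved.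

## References

* D. Gilbarg, N. S. Trudinger, *Elliptic Partial Differential Equations of Second Order* (2001),
  §17.4, (17.49)–(17.51) and the conclusion "`ω(R) ≤ δ̄ ω(2R) + C(…)`" on p. 480; Theorem 9.22.
  [GilbargTrudinger2001]
-/

noncomputable section

open Set InnerProductSpace Matrix Filter Metric MeasureTheory WithLp
open scoped Topology ENNReal RealInnerProductSpace

namespace Literature.Analysis.PDE.EvansKrylov

open Literature.Analysis.PDE.ABP Literature.Analysis.PDE.KrylovSafonov

variable {ι : Type*} [Fintype ι] [DecidableEq ι]

/-- The oscillation sum `ω(r) = Σ_k osc_{B(y₀,r)} h_k` (`osc_B h = sup_B h - inf_B h`).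
[cite: GilbargTrudinger2001, §17.4] -/
def oscSum {K : Type*} [Fintype K] (h : K → EuclideanSpace ℝ ι → ℝ) (y₀ : EuclideanSpace ℝ ι)
    (r : ℝ) : ℝ :=
  ∑ k, (sSup (h k '' ball y₀ r) - sInf (h k '' ball y₀ r))

/-- **Evans–Krylov oscillation decay** (Gilbarg–Trudinger §17.4, from (17.48) and the coupling
inequality to `ω(αR) ≤ δ̄ ω(R) + C(ε ω(R) + D₁R + f₀R²)`, with the small-ball weak Harnack
inequality `weakHarnack`, `α = alphaWH ι`). Constants `δ̄ ∈ (0,1)`, `C` depend only on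
`ι, λ, Λ, λ*, Λ*` and the number of functions. Data: an open `U`, a ball `B̄(y₀,R) ⊆ U`,
symmetric `λ`-`Λ`-elliptic coefficients `a` on `B(y₀,R)`, finitely many `C²` measurable functions
`h_k` with values in `[0,1]` on `B̄(y₀,R)`, `ε ∈ (0,1]`, `v = Σ h_k²`, `w_k = h_k + εv`
supersolutions `a : D²w_k ≥ −f₀` on `B(y₀,R)`, and weights `λ* ≤ β_k(y) ≤ Λ*` with the coupling
`Σ_k β_k(y)(h_k(y) − h_k(x)) ≤ D₁ R` for `x, y ∈ B(y₀,R)`.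
[cite: GilbargTrudinger2001, §17.4, (17.49)–(17.51)] -/
theorem oscillation_decay (ι : Type*) [Fintype ι] [DecidableEq ι] [Nonempty ι] (K : Type*)
    [Fintype K] [Nonempty K] {lam Λ lamS ΛS : ℝ} (hlam : 0 < lam) (hΛ : lam ≤ Λ)
    (hlamS : 0 < lamS) (hΛS : lamS ≤ ΛS) :
    ∃ δ C : ℝ, 0 < δ ∧ δ < 1 ∧ 0 ≤ C ∧
      ∀ {U : Set (EuclideanSpace ℝ ι)}, IsOpen U →
      ∀ {y₀ : EuclideanSpace ℝ ι} {R : ℝ}, 0 < R → closedBall y₀ R ⊆ U →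
      ∀ {a : EuclideanSpace ℝ ι → Matrix ι ι ℝ}, (∀ y ∈ ball y₀ R, (a y).IsSymm) →
        (∀ y ∈ ball y₀ R, ∀ ξ : ι → ℝ, lam * (ξ ⬝ᵥ ξ) ≤ ξ ⬝ᵥ (a y *ᵥ ξ)) →
        (∀ y ∈ ball y₀ R, ∀ ξ : ι → ℝ, ξ ⬝ᵥ (a y *ᵥ ξ) ≤ Λ * (ξ ⬝ᵥ ξ)) →
      ∀ {h : K → EuclideanSpace ℝ ι → ℝ}, (∀ k, ContDiffOn ℝ 2 (h k) U) →
        (∀ k, Measurable (h k)) → (∀ k, ∀ y ∈ closedBall y₀ R, 0 ≤ h k y ∧ h k y ≤ 1) →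
      ∀ {ε : ℝ}, 0 < ε → ε ≤ 1 →
      ∀ {f₀ : ℝ}, 0 ≤ f₀ →
        (∀ k, ∀ y ∈ ball y₀ R,
          -f₀ ≤ pair (a y) (hessianMatrix
            (fun x ↦ h k x + ε * ∑ l, h l x ^ 2) (EuclideanSpace.basisFun ι ℝ) y)) →
      ∀ {β : EuclideanSpace ℝ ι → K → ℝ}, (∀ y ∈ ball y₀ R, ∀ k, lamS ≤ β y k ∧ β y k ≤ ΛS) →
      ∀ {D₁ : ℝ}, 0 ≤ D₁ →
        (∀ x ∈ ball y₀ R, ∀ y ∈ ball y₀ R, ∑ k, β y k * (h k y - h k x) ≤ D₁ * R) →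
      oscSum h y₀ (alphaWH ι * R) ≤
        δ * oscSum h y₀ R + C * (ε * oscSum h y₀ R + D₁ * R + f₀ * R ^ 2) := by
  classical
  -- the constants
  set n := Fintype.card ι with hn
  set α := alphaWH ι with hα
  set p := pWH ι (Λ / lam) with hp
  set CW := CWH ι (Λ / lam) with hCW
  set b₁ := (volume (ball (0 : EuclideanSpace ℝ ι) 1)).toReal with hb₁
  set N₀ : ℝ := (Fintype.card K : ℝ) with hN₀
  set c₁ : ℝ := 1 + 1 / lamS + ΛS / lamS with hc₁
  set Q : ℝ := CW / (α ^ n * b₁) * N₀ ^ (1 - p) with hQ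
  set A : ℝ := max 1 (c₁ * Q ^ p⁻¹) with hA
  have hratio : 1 ≤ Λ / lam := by rwa [le_div_iff₀ hlam, one_mul]
  have hratio0 : 0 ≤ Λ / lam := zero_le_one.trans hratio
  have hp0 : 0 < p := pWH_pos hratio0
  have hp1 : p ≤ 1 := pWH_le_one hratio
  have hCW0 : 0 < CW := CWH_pos hratio0
  obtain ⟨hα0, hα1, -⟩ := alphaWH_bounds (ι := ι)
  have hb₁0 : 0 < b₁ :=
    ENNReal.toReal_pos (measure_ball_pos volume _ one_pos).ne' measure_ball_lt_top.ne
  have hN₀1 : 1 ≤ N₀ := by rw [hN₀]; exact_mod_cast Fintype.card_pos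
  have hN₀0 : 0 < N₀ := by linarith
  have hc₁1 : 1 ≤ c₁ := by
    have : 0 ≤ 1 / lamS := by positivity
    have : 0 ≤ ΛS / lamS := div_nonneg (hlamS.le.trans hΛS) hlamS.le
    rw [hc₁]; linarith
  have hc₁0 : 0 ≤ c₁ := zero_le_one.trans hc₁1
  have hQ0 : 0 ≤ Q := by positivity
  have hA1 : 1 ≤ A := le_max_left _ _
  obtain ⟨hδ0, hδ1⟩ := delta_mem_Ioo hp0 hN₀1 hA1
  refine ⟨1 - 1 / (N₀ * (2 : ℝ) ^ p⁻¹ * A), (c₁ + 3 * N₀) * (1 + 1 / lam), hδ0, hδ1,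
    by positivity, ?_⟩
  intro U hU y₀ R hR hBU a ha hlamE hΛE h hh hhm h01 ε hε hε1 f₀ hf₀ hsup β hβ D₁ hD₁ hcoup
  -- radii
  have hαR : 0 < α * R := mul_pos hα0 hR
  have hαR' : α * R ≤ R := by nlinarith
  have hsB : ball y₀ (α * R) ⊆ ball y₀ R := ball_subset_ball hαR'
  -- suprema and infima of the `h_k` over the two balls
  set M : K → ℝ := fun k ↦ sSup (h k '' ball y₀ R) with hM
  set m : K → ℝ := fun k ↦ sInf (h k '' ball y₀ R) with hm
  set M' : K → ℝ := fun k ↦ sSup (h k '' ball y₀ (α * R)) with hM'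
  set m' : K → ℝ := fun k ↦ sInf (h k '' ball y₀ (α * R)) with hm'
  have hB : ∀ k, ∀ y ∈ ball y₀ R, m k ≤ h k y ∧ h k y ≤ M k := fun k y hy ↦
    csInf_le_le_csSup_image_ball le_rfl (h01 k) hy
  have hcl : ∀ k, ∀ y ∈ closedBall y₀ R, m k ≤ h k y ∧ h k y ≤ M k := fun k y hy ↦
    csInf_le_le_csSup_of_mem_closedBall hR (h01 k) ((hh k).continuousOn.mono hBU) hy
  have h01B : ∀ k, 0 ≤ m k ∧ m k ≤ M k ∧ M k ≤ 1 := fun k ↦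
    csInf_csSup_image_ball_mem hR le_rfl (h01 k)
  have h01Bs : ∀ k, 0 ≤ m' k ∧ m' k ≤ M' k ∧ M' k ≤ 1 := fun k ↦
    csInf_csSup_image_ball_mem hαR hαR' (h01 k)
  have hmono : ∀ k, M' k ≤ M k ∧ m k ≤ m' k := fun k ↦ csSup_image_ball_mono hαR hαR' (h01 k)
  -- the oscillation sums
  set ω := ∑ k, (M k - m k) with hω
  set ωs := ∑ k, (M' k - m' k) with hωs
  have hgoal : oscSum h y₀ (α * R) = ωs ∧ oscSum h y₀ R = ω := ⟨rfl, rfl⟩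
  rw [hgoal.1, hgoal.2]
  have hωs0 : 0 ≤ ωs := Finset.sum_nonneg fun k _ ↦ by linarith [(h01Bs k).2.1]
  have hωsω : ωs ≤ ω := Finset.sum_le_sum fun k _ ↦ by linarith [(hmono k).1, (hmono k).2]
  have hω0 : 0 ≤ ω := hωs0.trans hωsω
  have hMM' : ∑ k, (M k - M' k) ≤ ω - ωs := by
    rw [hω, hωs, ← Finset.sum_sub_distrib]
    exact Finset.sum_le_sum fun k _ ↦ by linarith [(hmono k).2]
  -- the degenerate case `ω = 0`
  rcases hω0.eq_or_lt with hω00 | hωpos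
  · rw [← hω00]
    have : 0 ≤ (c₁ + 3 * N₀) * (1 + 1 / lam) * (ε * 0 + D₁ * R + f₀ * R ^ 2) := by positivity
    linarith
  -- the main case: the level `N = f₀R²/λ + εω > 0`
  set N : ℝ := f₀ * R ^ 2 / lam + ε * ω with hNdef
  have hεω : 0 < ε * ω := mul_pos hε hωpos
  have hN0 : 0 < N := by rw [hNdef]; positivity
  have hNf : R ^ 2 * f₀ / lam ≤ N := by rw [hNdef, mul_comm (R ^ 2)]; linarith
  -- (17.49) for each direction `k`
  have hstar : ∀ k, ∫⁻ y in ball y₀ (α * R), ENNReal.ofReal ((M k - h k y + N) ^ p) ≤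
      ENNReal.ofReal (CW * R ^ n * (M k - M' k + 2 * ε * ω + N) ^ p) := fun k ↦
    setLIntegral_rpow_sup_sub_le hU hR hBU ha hlam hΛ hlamE hΛE hh hhm hcl
      (fun k ↦ (h01B k).1) (fun k ↦ (h01B k).2.2) hε.le hf₀ hsup hN0 hNf k
  -- choose the direction with the largest oscillation
  obtain ⟨l, -, hl⟩ : ∃ l ∈ Finset.univ, (ω + 2 * N₀ * N) / N₀ ≤ (M l - m l) + 2 * N := by
    refine Finset.exists_le_of_sum_le Finset.univ_nonempty (le_of_eq ?_)
    rw [Finset.sum_const, Finset.card_univ, nsmul_eq_mul, Finset.sum_add_distrib, Finset.sum_const,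
      Finset.card_univ, nsmul_eq_mul, ← hω, ← hN₀]
    field_simp
  -- (17.50)–(17.51), pointwise on the small ball
  have hne : ∀ k, (h k '' ball y₀ R).Nonempty := fun k ↦ (nonempty_ball.2 hR).image _
  have hpt : ∀ y ∈ ball y₀ (α * R),
      (M l - m l) + 2 * N ≤ c₁ * (D₁ * R + N + ∑ k, (M k - h k y + N)) := fun y hy ↦
    osc_add_two_mul_le_pointwise hlamS hΛS hB l
      (fun t ht ↦ le_csInf (hne l) (by rintro _ ⟨x, hx, rfl⟩; exact ht x hx)) hβ
      (by positivity) hcoup hN0.le (hsB hy)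
  -- integrate over the small ball and divide by its volume
  set z : K → ℝ := fun k ↦ M k - M' k + 2 * ε * ω + N with hz
  have hz0 : ∀ k, 0 ≤ z k := fun k ↦ by simp only [hz]; linarith [(hmono k).1]
  have hint := rpow_mul_measure_le_of_pointwise (μ := volume) (s := ball y₀ (α * R))
    measurableSet_ball measure_ball_lt_top.ne (G := fun k y ↦ M k - h k y + N)
    (fun k ↦ (measurable_const.sub (hhm k)).add_const N)
    (fun k y hy ↦ by linarith [(hB k y (hsB hy)).2]) hc₁0 (by positivity : 0 ≤ D₁ * R + N)
    (by linarith [(h01B l).2.1] : 0 ≤ M l - m l + 2 * N) hp0 hp1 hpt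
    (T := fun k ↦ CW * R ^ n * z k ^ p)
    (fun k ↦ mul_nonneg (by positivity) (Real.rpow_nonneg (hz0 k) _)) hstar
  rw [volume_ball_toReal y₀ hαR] at hint
  replace hint : (M l - m l + 2 * N) ^ p * ((α * R) ^ n * b₁) ≤
      c₁ ^ p * ((D₁ * R + N) ^ p * ((α * R) ^ n * b₁) + ∑ k, CW * R ^ n * z k ^ p) := hint
  have hV0 : 0 < (α * R) ^ n * b₁ := by positivity
  have hαb : α ^ n * b₁ ≠ 0 := by positivity
  have hkey : (M l - m l + 2 * N) ^ p ≤
      c₁ ^ p * (D₁ * R + N) ^ p + c₁ ^ p * (CW / (α ^ n * b₁)) * ∑ k, z k ^ p := by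
    refine le_of_mul_le_mul_right (hint.trans_eq ?_) hV0
    have e : CW / (α ^ n * b₁) * (α ^ n * b₁) = CW := div_mul_cancel₀ CW hαb
    rw [← Finset.mul_sum, mul_pow]
    calc c₁ ^ p * ((D₁ * R + N) ^ p * (α ^ n * R ^ n * b₁) + CW * R ^ n * ∑ k, z k ^ p)
        = c₁ ^ p * ((D₁ * R + N) ^ p * (α ^ n * R ^ n * b₁)) +
          c₁ ^ p * (CW / (α ^ n * b₁) * (α ^ n * b₁)) * R ^ n * ∑ k, z k ^ p := by rw [e]; ring
      _ = _ := by ring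
  -- power mean
  have hsumz : ∑ k, z k = ∑ k, (M k - M' k) + N₀ * (2 * ε * ω + N) := by
    simp only [hz, Finset.sum_add_distrib, Finset.sum_const, Finset.card_univ, nsmul_eq_mul, hN₀]
    ring
  have hZle : ∑ k, z k ≤ ω - ωs + N₀ * (2 * ε * ω + N) := by rw [hsumz]; linarith
  have hpm : ∑ k, z k ^ p ≤ N₀ ^ (1 - p) * (ω - ωs + N₀ * (2 * ε * ω + N)) ^ p := by
    have hz00 : 0 ≤ ∑ k, z k := Finset.sum_nonneg fun k _ ↦ hz0 k
    calc ∑ k, z k ^ p ≤ (Finset.univ.card : ℝ) ^ (1 - p) * (∑ k, z k) ^ p :=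
          sum_rpow_le_card_rpow_sum hp0.le hp1 _ Finset.univ_nonempty fun k _ ↦ hz0 k
      _ ≤ N₀ ^ (1 - p) * (ω - ωs + N₀ * (2 * ε * ω + N)) ^ p := by
          rw [Finset.card_univ, ← hN₀]
          exact mul_le_mul_of_nonneg_left (Real.rpow_le_rpow hz00 hZle hp0.le) (by positivity)
  -- the inequality fed to the final bookkeeping
  have hX : ((ω + 2 * N₀ * N) / N₀) ^ p ≤
      c₁ ^ p * (D₁ * R + N) ^ p + c₁ ^ p * Q * (ω - ωs + N₀ * (2 * ε * ω + N)) ^ p := by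
    have hX0 : 0 ≤ (ω + 2 * N₀ * N) / N₀ := by positivity
    calc ((ω + 2 * N₀ * N) / N₀) ^ p ≤ (M l - m l + 2 * N) ^ p := Real.rpow_le_rpow hX0 hl hp0.le
      _ ≤ c₁ ^ p * (D₁ * R + N) ^ p + c₁ ^ p * (CW / (α ^ n * b₁)) * ∑ k, z k ^ p := hkey
      _ ≤ c₁ ^ p * (D₁ * R + N) ^ p + c₁ ^ p * (CW / (α ^ n * b₁)) *
            (N₀ ^ (1 - p) * (ω - ωs + N₀ * (2 * ε * ω + N)) ^ p) := by gcongr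
      _ = _ := by simp only [hQ]; ring
  exact oscillation_decay_algebra hp0 hQ0 hc₁1 hN₀1 hlam hωs0 hωsω hε.le
    (by positivity : 0 ≤ D₁ * R) (by positivity : 0 ≤ f₀ * R ^ 2) (by rw [hNdef]) hX

end Literature.Analysis.PDE.EvansKrylov
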